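import Literature.Barriers.MatrixMultiplication.UniversalMethodBarrierDegeneration
import HarnessLib

/-!
# Degeneration calculus II: transitivity, powers, relabelling, rotation under symmetry

Topic `Literature/Barriers/MatrixMultiplication`; part of the PROOF of `UniversalMethodBarrier`
(Alman 2021), continuing `UniversalMethodBarrierDegeneration.lean`. Everything is PROVED, over a
commutative semiring.

## Content (Alman 2021, §2.4, §2.6 and the proof of Thm. 2.9)

* `polySubst_comp`, `polySubst_expand`, `IsPolyDegen.coeff_expand`, `IsPolyDegen.trans`,
  `PolyDegeneratesTo.trans` — **degeneration is transitive**. (Naively composing orders `h` and `h'`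
  fails because the unknown coefficients above `λ^h` of the first degeneration pollute the orders
  `≤ h + h'`; substituting `λ ↦ λ^{h'+1}` in the first degeneration first makes it clean up to order
  `(h'+1)h + h'`, and the composite has order `(h'+1)h + h'`.)
* `kroneckerTensor_kroneckerPow_eq`, `PolyDegeneratesTo.kroneckerPow` — `t ⊵ s ⇒ t^{⊗N} ⊵ s^{⊗N}`;
  `PolyDegeneratesTo.reindex`, `PolyDegeneratesTo.of_reindex`.
* `IsVariableSymmetric.kroneckerPow`, `IsVariableSymmetric.polyDegeneratesTo_rotate` — for a
  variable-symmetric `t`, `t ⊵ s ⇒ t ⊵ rot(s)` with the rotated maps `(B, C, A)` (the step "since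
  `T` is symmetric, `T^{⊗n}` also has a degeneration to `F ⊙ ⟨b,c,a⟩`" of the proof of Thm. 2.9).

## References

* J. Alman, *Limits on the Universal Method for Matrix Multiplication*, Theory of Computing 17
  (2021), §2.4, §2.6, Thm. 2.9 (held: `doi-10-4086-toc-2021-v017a001`, pp. 10–14). [Alman2021]
-/

noncomputable section

open scoped BigOperators Polynomial

namespace Literature.Barriers.MatrixMultiplication

open Literature.Computability.AlgebraicComplexity

universe u

section Trans

variable {K : Type u} [CommSemiring K]
variable {ι κ μ ι' κ' μ' ι'' κ'' μ'' : Type*}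

/-! ### Transitivity (spreading orders with `λ ↦ λᵏ`) -/

/-- Composing substitutions with polynomial second-stage maps. [cite: Alman2021, §2.4] -/
theorem polySubst_comp [Fintype ι] [Fintype κ] [Fintype μ] [Fintype ι'] [Fintype κ'] [Fintype μ']
    (t : ι → κ → μ → K) (A : ι → ι' → K[X]) (B : κ → κ' → K[X]) (C : μ → μ' → K[X])
    (A' : ι' → ι'' → K[X]) (B' : κ' → κ'' → K[X]) (C' : μ' → μ'' → K[X]) (a'' : ι'') (b'' : κ'')
    (c'' : μ'') :
    polySubst t (fun a a'' => ∑ a', A a a' * A' a' a'') (fun b b'' => ∑ b', B b b' * B' b' b'')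
        (fun c c'' => ∑ c', C c c' * C' c' c'') a'' b'' c'' =
      ∑ a', ∑ b', ∑ c', polySubst t A B C a' b' c' * (A' a' a'' * B' b' b'' * C' c' c'') := by
  simp only [polySubst]
  simp only [mul_sum_mul_sum_mul_sum]
  simp only [Finset.sum_mul]
  -- LHS binders `a b c a' b' c'`, RHS binders `a' b' c' a b c`
  rw [sum_comm₃]
  refine Finset.sum_congr rfl fun a' _ => Finset.sum_congr rfl fun b' _ =>
    Finset.sum_congr rfl fun c' _ => Finset.sum_congr rfl fun a _ =>
    Finset.sum_congr rfl fun b _ => Finset.sum_congr rfl fun c _ => ?_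
  ring

/-- Substituting with `λ ↦ λᵏ` applied to the maps expands the substituted tensor.
[cite: Alman2021, §2.4] -/
theorem polySubst_expand [Fintype ι] [Fintype κ] [Fintype μ] (t : ι → κ → μ → K)
    (A : ι → ι' → K[X]) (B : κ → κ' → K[X]) (C : μ → μ' → K[X]) (k : ℕ) (a' : ι') (b' : κ')
    (c' : μ') :
    polySubst t (fun a a' => Polynomial.expand K k (A a a')) (fun b b' => Polynomial.expand K k (B b b'))
        (fun c c' => Polynomial.expand K k (C c c')) a' b' c' =
      Polynomial.expand K k (polySubst t A B C a' b' c') := by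
  simp only [polySubst, map_sum, map_mul, Polynomial.expand_C]

/-- After `λ ↦ λᵏ` (`k ≥ 1`) a degeneration of order `h` becomes one of order `kh` which is
moreover clean up to order `kh + (k - 1)`. [cite: Alman2021, §2.4] -/
theorem IsPolyDegen.coeff_expand [Fintype ι] [Fintype κ] [Fintype μ] {h : ℕ} {t : ι → κ → μ → K}
    {s : ι' → κ' → μ' → K} {A : ι → ι' → K[X]} {B : κ → κ' → K[X]} {C : μ → μ' → K[X]}
    (hd : IsPolyDegen h t s A B C) {k : ℕ} (hk : 0 < k) (a' : ι') (b' : κ') (c' : μ') (m : ℕ)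
    (hm : m ≤ k * h + (k - 1)) :
    (polySubst t (fun a a' => Polynomial.expand K k (A a a'))
        (fun b b' => Polynomial.expand K k (B b b')) (fun c c' => Polynomial.expand K k (C c c'))
        a' b' c').coeff m = if m = k * h then s a' b' c' else 0 := by
  rw [polySubst_expand, Polynomial.coeff_expand hk]
  by_cases hdvd : k ∣ m
  · obtain ⟨q, rfl⟩ := hdvd
    have hq : q ≤ h := by
      by_contra hlt
      have : k * (h + 1) ≤ k * q := Nat.mul_le_mul_left k (by omega)
      have : k * (h + 1) = k * h + k := by ring
      omega
    rw [if_pos (dvd_mul_right k q), Nat.mul_div_cancel_left q hk, hd a' b' c' q hq]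
    by_cases hqh : q = h
    · subst hqh; simp
    · rw [if_neg hqh, if_neg (fun e => hqh (Nat.eq_of_mul_eq_mul_left hk e))]
  · rw [if_neg hdvd, if_neg (fun e : m = k * h => hdvd (e ▸ dvd_mul_right k h))]

/-- **Transitivity of degeneration** (Alman 2021, §2.4; Strassen): if `t ⊵ s` with order `h` and
`s ⊵ p` with order `h'`, then substituting `λ ↦ λ^{h'+1}` in the first and composing gives
`t ⊵ p` with order `(h'+1)h + h'`. [cite: Alman2021, §2.4] -/
theorem IsPolyDegen.trans [Fintype ι] [Fintype κ] [Fintype μ] [Fintype ι'] [Fintype κ']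
    [Fintype μ'] {h h' : ℕ} {t : ι → κ → μ → K} {s : ι' → κ' → μ' → K} {p : ι'' → κ'' → μ'' → K}
    {A : ι → ι' → K[X]} {B : κ → κ' → K[X]} {C : μ → μ' → K[X]} (hd : IsPolyDegen h t s A B C)
    {A' : ι' → ι'' → K[X]} {B' : κ' → κ'' → K[X]} {C' : μ' → μ'' → K[X]}
    (hd' : IsPolyDegen h' s p A' B' C') :
    IsPolyDegen ((h' + 1) * h + h') t p
      (fun a a'' => ∑ a', Polynomial.expand K (h' + 1) (A a a') * A' a' a'')
      (fun b b'' => ∑ b', Polynomial.expand K (h' + 1) (B b b') * B' b' b'')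
      (fun c c'' => ∑ c', Polynomial.expand K (h' + 1) (C c c') * C' c' c'') := by
  intro a'' b'' c'' j hj
  rw [polySubst_comp]
  -- fold the triple sum into one sum over `ι' × κ' × μ'`
  have fold : (∑ a', ∑ b', ∑ c', polySubst t (fun a a' => Polynomial.expand K (h' + 1) (A a a'))
      (fun b b' => Polynomial.expand K (h' + 1) (B b b')) (fun c c' => Polynomial.expand K (h' + 1) (C c c'))
      a' b' c' * (A' a' a'' * B' b' b'' * C' c' c'')) =
      ∑ x : ι' × κ' × μ', polySubst t (fun a a' => Polynomial.expand K (h' + 1) (A a a'))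
      (fun b b' => Polynomial.expand K (h' + 1) (B b b')) (fun c c' => Polynomial.expand K (h' + 1) (C c c'))
      x.1 x.2.1 x.2.2 * (A' x.1 a'' * B' x.2.1 b'' * C' x.2.2 c'') := by
    symm
    rw [Fintype.sum_prod_type]
    exact Finset.sum_congr rfl fun a' _ => by rw [Fintype.sum_prod_type]
  rw [fold, coeff_sum_mul_of_clean Finset.univ (e := (h' + 1) * h) (m := (h' + 1) * h + h')
    (x := fun x : ι' × κ' × μ' => s x.1 x.2.1 x.2.2)
    (fun x _ i hi => hd.coeff_expand (Nat.succ_pos h') x.1 x.2.1 x.2.2 i (by simpa using hi)) j hj]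
  by_cases hle : (h' + 1) * h ≤ j
  · rw [if_pos hle]
    have hj' : j - (h' + 1) * h ≤ h' := by omega
    have key : (∑ x : ι' × κ' × μ', Polynomial.C (s x.1 x.2.1 x.2.2) *
        (A' x.1 a'' * B' x.2.1 b'' * C' x.2.2 c'')) = polySubst s A' B' C' a'' b'' c'' := by
      simp only [polySubst]
      rw [Fintype.sum_prod_type]
      exact Finset.sum_congr rfl fun a' _ => by rw [Fintype.sum_prod_type]
    rw [key, hd' a'' b'' c'' _ hj']
    by_cases hjj : j = (h' + 1) * h + h'
    · rw [if_pos hjj, if_pos (by omega)]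
    · rw [if_neg hjj, if_neg (by omega)]
  · rw [if_neg hle, if_neg (by omega)]

/-- **Degeneration is transitive**: `t ⊵ s ⊵ p ⇒ t ⊵ p`. [cite: Alman2021, §2.4] -/
theorem PolyDegeneratesTo.trans [Fintype ι] [Fintype κ] [Fintype μ] [Fintype ι'] [Fintype κ']
    [Fintype μ'] {t : ι → κ → μ → K} {s : ι' → κ' → μ' → K} {p : ι'' → κ'' → μ'' → K}
    (hts : PolyDegeneratesTo t s) (hsp : PolyDegeneratesTo s p) : PolyDegeneratesTo t p := by
  obtain ⟨h, A, B, C, hd⟩ := hts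
  obtain ⟨h', A', B', C', hd'⟩ := hsp
  exact (IsPolyDegen.trans hd hd').polyDegeneratesTo

end Trans

/-! ### Powers, reindexing, rotation -/

section Pow

variable {K : Type u} [CommSemiring K]
variable {ι κ μ ι' κ' μ' : Type*} [Fintype ι] [Fintype κ] [Fintype μ] [Fintype ι'] [Fintype κ']
  [Fintype μ']

omit [Fintype ι] [Fintype κ] [Fintype μ] in
/-- `t ⊗ t^{⊗N}` is a relabelling of `t^{⊗(N+1)}` (prepend a coordinate). [folklore] -/
theorem kroneckerTensor_kroneckerPow_eq (t : ι → κ → μ → K) (N : ℕ) :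
    kroneckerTensor t (kroneckerPow t N) = fun a b c =>
      kroneckerPow t (N + 1) (Fin.cons a.1 a.2) (Fin.cons b.1 b.2) (Fin.cons c.1 c.2) := by
  funext a b c
  rw [kroneckerPow_succ_eq]
  simp only [Fin.cons_zero, Fin.tail_cons]

/-- **Powers of a degeneration**: `t ⊵ s ⇒ t^{⊗N} ⊵ s^{⊗N}`. [cite: Alman2021, §2.4] -/
theorem PolyDegeneratesTo.kroneckerPow [DecidableEq ι] [DecidableEq κ] [DecidableEq μ]
    [DecidableEq ι'] [DecidableEq κ'] [DecidableEq μ'] {t : ι → κ → μ → K} {s : ι' → κ' → μ' → K}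
    (hts : PolyDegeneratesTo t s) (N : ℕ) :
    PolyDegeneratesTo (kroneckerPow t N) (kroneckerPow s N) := by
  induction N with
  | zero =>
    refine TensorRestrictsTo.polyDegeneratesTo ⟨fun _ _ => 1, fun _ _ => 1, fun _ _ => 1, ?_⟩
    intro a' b' c'
    simp [kroneckerPow_apply]
  | succ N ih =>
    -- `t^{⊗(N+1)} ≥ t ⊗ t^{⊗N} ⊵ s ⊗ s^{⊗N} ≥ s^{⊗(N+1)}`
    have h1 : TensorRestrictsTo (Literature.Computability.AlgebraicComplexity.kroneckerPow t (N + 1))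
        (kroneckerTensor t (Literature.Computability.AlgebraicComplexity.kroneckerPow t N)) := by
      rw [kroneckerTensor_kroneckerPow_eq]
      exact tensorRestrictsTo_precomp _ _ _ _
    have h3 : TensorRestrictsTo
        (kroneckerTensor s (Literature.Computability.AlgebraicComplexity.kroneckerPow s N))
        (Literature.Computability.AlgebraicComplexity.kroneckerPow s (N + 1)) := by
      rw [kroneckerPow_succ_eq s N]
      exact tensorRestrictsTo_precomp _ _ _ _
    exact (h1.trans_polyDegeneratesTo (hts.kronecker ih)).trans_restrictsTo h3

/-- Degeneration is invariant under relabelling the target along bijections. [cite: Alman2021, §2.4] -/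
theorem PolyDegeneratesTo.reindex {ι'' κ'' μ'' : Type*} [Fintype ι''] [Fintype κ''] [Fintype μ'']
    [DecidableEq ι'] [DecidableEq κ'] [DecidableEq μ'] [DecidableEq ι''] [DecidableEq κ'']
    [DecidableEq μ''] {t : ι → κ → μ → K} {s : ι' → κ' → μ' → K} (hts : PolyDegeneratesTo t s)
    (e₁ : ι'' ≃ ι') (e₂ : κ'' ≃ κ') (e₃ : μ'' ≃ μ') :
    PolyDegeneratesTo t (fun a b c => s (e₁ a) (e₂ b) (e₃ c)) :=
  hts.trans_restrictsTo (tensorRestrictsTo_precomp s e₁ e₂ e₃)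

omit [Fintype ι'] [Fintype κ'] [Fintype μ'] in
/-- Degeneration is invariant under relabelling the source along bijections. [cite: Alman2021, §2.4] -/
theorem PolyDegeneratesTo.of_reindex {ι₀ κ₀ μ₀ : Type*} [Fintype ι₀] [Fintype κ₀] [Fintype μ₀]
    [DecidableEq ι] [DecidableEq κ] [DecidableEq μ] [DecidableEq ι₀] [DecidableEq κ₀]
    [DecidableEq μ₀] {t : ι → κ → μ → K} {s : ι' → κ' → μ' → K}
    (e₁ : ι₀ ≃ ι) (e₂ : κ₀ ≃ κ) (e₃ : μ₀ ≃ μ)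
    (hts : PolyDegeneratesTo (fun a b c => t (e₁ a) (e₂ b) (e₃ c)) s) : PolyDegeneratesTo t s :=
  (tensorRestrictsTo_precomp t e₁ e₂ e₃).trans_polyDegeneratesTo hts

omit [Fintype ι] in
/-- Powers of a variable-symmetric tensor are variable-symmetric. [cite: Alman2021, §2.6] -/
theorem IsVariableSymmetric.kroneckerPow {t : ι → ι → ι → K} (ht : IsVariableSymmetric t) (N : ℕ) :
    IsVariableSymmetric (Literature.Computability.AlgebraicComplexity.kroneckerPow t N) := by
  intro a b c
  simp only [kroneckerPow_apply]
  exact Finset.prod_congr rfl fun i _ => ht _ _ _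

omit [Fintype ι'] [Fintype κ'] [Fintype μ'] in
/-- **Rotating the target of a degeneration from a variable-symmetric tensor** (Alman 2021, proof
of Thm. 2.9: "since `T` is symmetric, `T^{⊗n}` also has a degeneration to `F ⊙ ⟨b,c,a⟩` and to
`F ⊙ ⟨c,a,b⟩`"): `t ⊵ s ⇒ t ⊵ rot(s)`, using the maps `(B, C, A)`. [cite: Alman2021, Thm. 2.9 (proof)] -/
theorem IsVariableSymmetric.polyDegeneratesTo_rotate {t : ι → ι → ι → K} (ht : IsVariableSymmetric t)
    {s : ι' → κ' → μ' → K} (hts : PolyDegeneratesTo t s) : PolyDegeneratesTo t (rotate s) := by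
  obtain ⟨h, A, B, C, hd⟩ := hts
  refine ⟨h, B, C, A, fun b' c' a' j hj => ?_⟩
  have key : polySubst t B C A b' c' a' = polySubst t A B C a' b' c' := by
    simp only [polySubst]
    -- rename the summation `(a, b, c) ↦ (c, a, b)` using `t a b c = t c a b`
    conv_lhs => rw [sum_rotate₃]
    refine Finset.sum_congr rfl fun a _ => Finset.sum_congr rfl fun b _ =>
      Finset.sum_congr rfl fun c _ => ?_
    rw [← ht a b c]
    ring
  rw [rotate_apply, show (∑ a, ∑ b, ∑ c, Polynomial.C (t a b c) * (B a b' * C b c' * A c a')) =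
    polySubst t B C A b' c' a' from rfl, key]
  exact hd a' b' c' j hj

end Pow



end Literature.Barriers.MatrixMultiplication

end
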